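import Summits.QuantumFields.BalabanUV.T4Continuum.Support.ShellMeasureLandauWilsonSquaresLocated
import Summits.QuantumFields.BalabanUV.T4Continuum.Support.ShellMeasureLandauPinnedKernels

/-!
# `T4Continuum.ShellMeasureLandauWilsonSquaresKernels` — row S80 «ASSEMBLED», file 2a: THE LOCATED WILSON SUPPLIER AT THE
# READING OF RECORD WITH EVERY PINNED CHAIN BINDER INHABITED (S74 f3 ∘ S81), and with the four linear letters'
# pinned bounds read from DISPLAYED DECAY KERNELS (∘ S69 (A))
(cell `pub-balaban`, sub-cell `t4`, spine estimate NE7c (node U5b); NE7c ROUND-2 crew, unit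
`b2b-balaban-t4-ne7c-formalise-leaf-04` gen 7 — my lineage's booked row S80 of `t4/b2b-balaban-t4-ne7c-p1/LEAVES-NE7c-P1.md`
(owner R-ne7cp1-g32-1 «the fully composed corollary — at the holder's discretion»; INTENT journal l.18177, following
leaf-07-g7's pointer l.17891); ADDITIVE — imports S74 f3 `ShellMeasureLandauWilsonSquaresLocated` (leaf-09-g11, p227502) and
S81 f2 `ShellMeasureLandauPinnedKernels` (leaf-07-g7, p227859; hence S81 f1 p227440, S75, S69) ONLY; [folklore]; 0 `def`,
0 `def … : Prop`, 0 sorry, 0 citation)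

HONEST FRAMING.  Finite four-torus programme, rung (B)+1 only — NOT infinite volume, NOT a mass gap, NOT the Clay
problem, NOT summit progress; (B), `BetaPertHyp`, (B^μ) not consumed.  NE7c (`T4IndicatorShell.ShellWeightBound`) is
NOT PRINTED in [Balaban 1983–89] and NOT PROVED; «NE7c ⇐ the named binders» (trigger c3).  Nothing printed is asserted
here; equation numbers are LOCATORS of displayed TYPES; no estimate of Bałaban's is discharged.  PLUMBING on OUR side:
two compositions BY NAME of landed declarations.

THE POINT.  The Wilson slot of the END-II-final of record (S76 f2 ∕ S80 `…_assembled`) is fired by S74's chart-ray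
supplier; its located form S74 f3 `hE_landau_wilsonSquares_located` still DISPLAYS leaf-07-g6's six pinned chain binders
`hGWp`∕`hqW`, `hCp`∕`hk`, `hιp`, `hHp`, `hH₁p`, `hΦp`∕`hbp` (WALL §2b rows `𝒢 V`, `W𝒱`, `H₁∕Hop∕ιs`, `Cf`, `Φ`: «pinned … [T]
W-a + W-h»).  Row S81 (f1 `hCp_of_local`, `hGWp_of_pinnedLipschitz`; f2 `norm_conj_kerOp_le`, `hWp_of_local`,
`hGWp_of_local`, `hΦp_of_support`) inhabits all six AT THE READING OF RECORD — all chain spaces flat pi-types, readings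
`(toPiL (pinW δ′ ϖ·) 1).symm` — from (i) the four LINEAR letters given as kernel operators `kerOp k` with bounds on
their S69 conjugates, (ii) LOCALITY of the (P4) letter and of the (44) letter with reaches `r_W`, `r_C`, (iii) the block
support of the coarse field.  This file fires them INTO THE WILSON SUPPLIER:
* §1 **`hE_landau_wilsonSquares_located_of_kernels`** := S74 f3 with `𝒵 := Λz → ℭ`, `𝒴′ := Λ′ → 𝔄′`, `𝒳 := Λx → 𝔅`,
  `ℬ := Λb → 𝔇`, `𝒢 ι H H₁ := kerOp k𝒢 ∕ kι ∕ kH ∕ kH₁`, conjugate bounds `B_𝒢p c_ι B_H B₁ₚ` (S69 (A)'s OUTPUT SHAPE,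
  DISPLAYED), `hGWp := hGWp_of_local` (`q_W = B_𝒢p·(2C₄a₃e^{δ′r_W})`), `hCp := hCp_of_local` (Sect. C of the chain run at
  `R∕2`, so `hRC : 6(ε₄ + B₀b) ≤ R`; `L_C = 2C₂R·e^{δ′r_C}`), `hιp hHp hH₁p := norm_conj_kerOp_le`, `hΦp := hΦp_of_support`
  (`b_p := b`).  CONCLUSION = S74 f3's LITERALLY with those constants:
  `B_W = 3·(|β|·((d̄ + S̄)·S̄)·K)∕(r_Φ∕S − 1)`, `S̄ = κ̄_c z_pin + expTail₂(m_w κ̄_w z_pin)`,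
  **`z_pin = B₁ₚ·b∕((1 − B_𝒢p·(2C₄a₃e^{δ′r_W}))(1 − 2C₂R·e^{δ′r_C}·c_ι·B_H))`**.
* §2 **`hE_landau_wilsonSquares_located_of_decay`** := §1 with the four conjugate bounds DISCHARGED by S69 (A)
  `opNorm_kerOpPin_le`: pins `ϖ ∘ pos·` for ONE profile `ϖ` on a common position space `S` (one-sided `ρ`-Lipschitz,
  `ϖ x ≤ ϖ y + ρ x y`) and DISPLAYED DECAY KERNELS `‖k c b‖ ≤ c₀·e^{−δρ(pos c, pos b)}` with reduced-rate row sums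
  `Σ_b e^{−(δ−δ′)ρ(x, pos b)} ≤ M` per letter — `B_𝒢p := c_𝒢M_𝒢`, `c_ι := c_ιM_ι`, `B_H := c_HM_H`, `B₁ₚ := c₁M₁`.  So the
  Wilson supplier's located inputs read: the flat printed-TYPE lists ((P2), (P4) (97)–(98), (118)∕(121), (103), (75),
  (44), (46), (54)), four decay kernels ((3.133)∕Thm 3.3, (46), (103) decay-halves TYPE) with their row sums, two
  localities with reaches, one block support, the blind flat read-outs and the located count `K` — NOTHING PINNED LEFT
  DISPLAYED.  (S79 `opNorm_kerOpPin_eta_le` is the η-explicit alternative supplier of the same four bounds; not used here.)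
CONSUMER.  S76 f2's `hEW` slot ∕ the S80-type assembled END take §1∕§2 per exterior section `V` exactly as S80 takes S74 f2
(file 2b of this row, after leaf-09-g12's second-order (Schwarz) suppliers land, so that one END carries both).
η-BOOKKEEPING (N-ne7cp1-g31-3): as in S81 f2 — `c₀·M` η-free only as the product (S79); `C₄a₃`, `C₂R` the one-grid ∕
level-0 instance at the flat-sup reading (the `WMax` twin is leaf-07's, on GO).  DISPLAYED, NOT DISCHARGED (c2): the decay
kernels, the flat lists, the localities, W-c [dict]; nothing of Bałaban's at a live level is discharged; NOTHING in the
countdown moves; NE7c NOT PROVED; spine PROVED 0∕9.  HONEST DEPENDENCY (cell): continuum YM on T⁴ ⇐ BetaPertH ∧ nine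
spine estimates (0/9 proved); BetaPertH ⇐ (D1) ∧ (D4) ∧ CAP+tail; G-an2-4 gates asym, D1 and NE2/3/4.
-/

noncomputable section

open Set Metric NormedSpace
open scoped Matrix

namespace Summit.QuantumFields.BalabanUV.T4Continuum.ShellMeasureLandauWilsonSquaresKernels

open Literature.MathematicalPhysics.QuantumFieldTheory.Balaban1983to89
open B11Prop6Scheme (Prop4Hyp)
open T4ShellMeasurePlaquette (expTail₂)
open Summit.QuantumFields.BalabanUV.T4Continuum.ShellMeasureMultiGridNorms (WSup)
open Summit.QuantumFields.BalabanUV.T4Continuum.ShellMeasureDecayKernelSums (kerOp)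
open Summit.QuantumFields.BalabanUV.T4Continuum.ShellMeasurePinnedNorm (pinW kerOpPin opNorm_kerOpPin_le)
open Summit.QuantumFields.BalabanUV.T4Continuum.ShellMeasureLandauHolonomy (solAt landauExp)
open Summit.QuantumFields.BalabanUV.T4Continuum.ShellMeasureLandauHolonomyChart (holOf cplx)
open Summit.QuantumFields.BalabanUV.T4Continuum.ShellMeasureLandauPinnedLipschitz (hCp_of_local)
open Summit.QuantumFields.BalabanUV.T4Continuum.ShellMeasureLandauPinnedKernels (norm_conj_kerOp_le hGWp_of_local
  hΦp_of_support)
open Summit.QuantumFields.BalabanUV.T4Continuum.ShellMeasureLandauWilsonSquaresLocated (hE_landau_wilsonSquares_located)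

variable {Λ Λz Λ' Λx Λb : Type*} [Fintype Λ] [DecidableEq Λ] [Fintype Λz] [Fintype Λ'] [Fintype Λx] [Fintype Λb]
variable {𝔄 ℭ 𝔄' 𝔅 𝔇 : Type*} [NormedAddCommGroup 𝔄] [NormedSpace ℂ 𝔄] [CompleteSpace 𝔄]
  [NormedAddCommGroup ℭ] [NormedSpace ℂ ℭ] [NormedAddCommGroup 𝔄'] [NormedSpace ℂ 𝔄']
  [NormedAddCommGroup 𝔅] [NormedSpace ℂ 𝔅] [CompleteSpace 𝔅] [NormedAddCommGroup 𝔇] [NormedSpace ℂ 𝔇]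
variable {nM : Type*} [Fintype nM] [DecidableEq nM] [Nonempty nM]

/-! ## §1 S74 f3 with the six pinned chain binders inhabited by S81 -/

section Kernels

open scoped Matrix.Norms.L2Operator

/-- **END-II's `hE` FOR THE WILSON PART, FULLY LOCATED, AT THE READING OF RECORD — EVERY PINNED CHAIN BINDER INHABITED.**
S74 f3 `hE_landau_wilsonSquares_located` with all five chain spaces FLAT pi-types (`Λ → 𝔄`, `Λz → ℭ`, `Λ′ → 𝔄′`, `Λx → 𝔅`,
`Λb → 𝔇`; sup norms), readings `(toPiL (pinW δ′ ϖ·) 1).symm` with pins `ϖ ϖz ϖ′ ϖx ϖb`, `δ′ ≥ 0`.  FLAT lists VERBATIM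
((P2) `h𝒢`, (P4) `hW`, (118)∕(121) at `a = B₀b`, (103) `hH₁`, (75)-TYPE `hΦd`∕`hΦ0`∕`hΦ`, `hSr`, (44) `hCq`∕`hCd` AT RADIUS
`R` with **`hRC : 6(ε₄ + B₀b) ≤ R`** (Sect. C is run at `R∕2`), scaling `hι`, (46) `hH`, (54) `hq`); the four LINEAR letters
AS KERNEL OPERATORS `kerOp k𝒢 ∕ kι ∕ kH ∕ kH₁` with bounds `B_𝒢p c_ι B_H B₁ₚ` on their S69 conjugates (S69 (A)'s OUTPUT SHAPE —
DISPLAYED decay halves); LOCALITY of the (P4) letter (`NW`, reach `r_W`) and of the (44) letter (`NC`, reach `r_C`); the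
coarse field SUPPORTED ON THE BLOCK `{ϖb ≤ 0}`; smallness `B_𝒢p·(2C₄a₃e^{δ′r_W}) < 1`, `2C₂R·e^{δ′r_C}·c_ι·B_H < 1`; the
weight read-outs (blind off `supp p` at depth `ϖP p ≥ 0`, flat op-norms `κ̄_w`, curl op-norm `κ̄_c`, lengths `≤ m_w`,
skew on `𝓡𝒴`), the real structure, the unitary background plaquettes `‖B_p − 1‖ ≤ d_p ≤ d̄` and the located count
`Σ_p e^{−δ′ϖP p} ≤ K` VERBATIM from S74 f3.  CONCLUSION: END-II's `hE` for the Wilson ray profile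
`𝓔_W y := Σ_{p∈P_w} β(1 − Re tr(B_p·holOf (ℓw p) Z y)∕N)` with `B_𝓔 = 3·(|β|·((d̄ + S̄)·S̄)·K)∕(r_Φ∕S − 1)`,
`S̄ = κ̄_c z_pin + expTail₂(m_w(κ̄_w z_pin))`, `z_pin = B₁ₚ·b∕((1 − B_𝒢p·(2C₄a₃e^{δ′r_W}))(1 − 2C₂R·e^{δ′r_C}·c_ι·B_H))`.
Nothing printed is asserted; no estimate of Bałaban's discharged; NE7c NOT PROVED. [folklore] -/
theorem hE_landau_wilsonSquares_located_of_kernels {n : ℕ} {𝔭 : Type*} {W : Set (Fin n → ℝ)} {Pw : Finset 𝔭} {S : ℝ}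
    (hS : 0 < S) (hWS : W ⊆ closedBall (0 : Fin n → ℝ) S)
    {δ' : ℝ} (hδ' : 0 ≤ δ') (ϖ : Λ → ℝ) (ϖz : Λz → ℝ) (ϖ' : Λ' → ℝ) (ϖx : Λx → ℝ) (ϖb : Λb → ℝ)
    -- the four linear letters as kernel operators, with bounds on their S69 conjugates (DISPLAYED decay halves)
    (k𝒢 : Λ → Λz → (ℭ →L[ℂ] 𝔄)) (kι : Λ' → Λ → (𝔄 →L[ℂ] 𝔄')) (kH : Λ → Λx → (𝔅 →L[ℂ] 𝔄))
    (kH₁ : Λ → Λb → (𝔇 →L[ℂ] 𝔄)) {B𝒢p cι BH B₁p : ℝ} (hB𝒢p : 0 ≤ B𝒢p) (hcι : 0 ≤ cι) (hBH : 0 ≤ BH)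
    (hB₁p : 0 ≤ B₁p) (h𝒢p : ‖kerOpPin k𝒢 δ' ϖz ϖ‖ ≤ B𝒢p) (hιp : ‖kerOpPin kι δ' ϖ ϖ'‖ ≤ cι)
    (hHp : ‖kerOpPin kH δ' ϖx ϖ‖ ≤ BH) (hH₁p : ‖kerOpPin kH₁ δ' ϖb ϖ‖ ≤ B₁p)
    -- the flat lists
    {W𝒱 : (Λ → 𝔄) → (Λz → ℭ)} {B₀ C₄ a₃ ε₄ b : ℝ}
    (h𝒢 : ∀ f, ‖kerOp k𝒢 f‖ ≤ B₀ * ‖f‖) (hW : Prop4Hyp W𝒱 C₄ a₃) (hB₀ : 0 < B₀) (hC₄ : 0 ≤ C₄) (hε₄ : 0 ≤ ε₄)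
    (hdom : 2 * (ε₄ + B₀ * b) ≤ a₃) (hself : B₀ * C₄ * (ε₄ + B₀ * b) ^ 2 ≤ ε₄)
    (hcontr : 4 * B₀ * C₄ * (ε₄ + B₀ * b) < 1) (hH₁ : ∀ B, ‖kerOp kH₁ B‖ ≤ B₀ * ‖B‖)
    {Φ : (Fin n → ℂ) → (Λb → 𝔇)} {rΦ : ℝ} (hΦd : DifferentiableOn ℂ Φ (ball 0 rΦ)) (hΦ0 : Φ 0 = 0)
    (hΦ : ∀ z ∈ ball (0 : Fin n → ℂ) rΦ, ‖Φ z‖ < b) (hSr : S < rΦ)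
    {C : (Λ' → 𝔄') → (Λx → 𝔅)} {C₂ R : ℝ} (hC₂ : 0 ≤ C₂) (hCq : ∀ Z : Λ' → 𝔄', ‖Z‖ < R → ‖C Z‖ ≤ C₂ * ‖Z‖ ^ 2)
    (hCd : DifferentiableOn ℂ C (ball 0 R)) (hι : ∀ Y, ‖kerOp kι Y‖ ≤ ‖Y‖) (hH : ∀ X, ‖kerOp kH X‖ ≤ B₀ * ‖X‖)
    (hq : 9 * C₂ * B₀ * (ε₄ + B₀ * b) < 1) (hRC : 6 * (ε₄ + B₀ * b) ≤ R)
    -- localities with reaches (in place of `hGWp`'s `W`-half and of `hCp`) and the block support (in place of `hΦp`)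
    (NW : Λz → Λ → Prop) (hlocW : ∀ A A' : Λ → 𝔄, ∀ c, (∀ b', NW c b' → A b' = A' b') → W𝒱 A c = W𝒱 A' c)
    {rW : ℝ} (hreachW : ∀ c b', NW c b' → ϖz c - rW ≤ ϖ b')
    (NC : Λx → Λ' → Prop) (hlocC : ∀ A A' : Λ' → 𝔄', ∀ c, (∀ b', NC c b' → A b' = A' b') → C A c = C A' c)
    {rC : ℝ} (hreachC : ∀ c b', NC c b' → ϖx c - rC ≤ ϖ' b')
    (hsupp : ∀ z : Fin n → ℂ, ∀ i, 0 < ϖb i → Φ z i = 0)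
    -- smallness of the two contraction numbers in the pinned currency (DISPLAYED arithmetic)
    (hqW : B𝒢p * (2 * C₄ * a₃ * Real.exp (δ' * rW)) < 1) (hk : 2 * C₂ * R * Real.exp (δ' * rC) * cι * BH < 1)
    -- the weight read-outs: BLIND off located supports, FLAT op-norms, curl op-norm (DISPLAYED), lengths
    (ℓw : 𝔭 → List ((Λ → 𝔄) →L[ℂ] Matrix nM nM ℂ)) (supp : 𝔭 → Finset Λ) (ϖP : 𝔭 → ℝ)
    (hblind : ∀ p ∈ Pw, ∀ ℓ ∈ ℓw p, ∀ A A' : Λ → 𝔄, (∀ b' ∈ supp p, A b' = A' b') → ℓ A = ℓ A')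
    (hdepth : ∀ p ∈ Pw, ∀ b' ∈ supp p, ϖP p ≤ ϖ b') (hϖP : ∀ p ∈ Pw, 0 ≤ ϖP p)
    {κw' κc' : ℝ} (hκw' : 0 ≤ κw') (hκc' : 0 ≤ κc') (hℓw : ∀ p ∈ Pw, ∀ ℓ ∈ ℓw p, ‖ℓ‖ ≤ κw')
    (hcurl : ∀ p ∈ Pw, ‖(ℓw p).sum‖ ≤ κc')
    {mw : ℕ} (hlenw : ∀ p ∈ Pw, (ℓw p).length ≤ mw)
    -- the real structure (chain (A)) with SKEW weight read-outs (chain (E))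
    (𝓡𝒴 : AddSubgroup (Λ → 𝔄)) (h𝓡𝒴 : IsClosed (𝓡𝒴 : Set (Λ → 𝔄))) (𝓡𝒵 : AddSubgroup (Λz → ℭ))
    (𝓡𝒴' : AddSubgroup (Λ' → 𝔄')) (𝓡𝒳 : AddSubgroup (Λx → 𝔅)) (h𝓡𝒳 : IsClosed (𝓡𝒳 : Set (Λx → 𝔅)))
    (𝓡ℬ : AddSubgroup (Λb → 𝔇))
    (h𝒢r : ∀ f ∈ 𝓡𝒵, kerOp k𝒢 f ∈ 𝓡𝒴) (hWr : ∀ Y ∈ 𝓡𝒴, W𝒱 Y ∈ 𝓡𝒵) (hιr : ∀ Y ∈ 𝓡𝒴, kerOp kι Y ∈ 𝓡𝒴')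
    (hHr : ∀ X ∈ 𝓡𝒳, kerOp kH X ∈ 𝓡𝒴) (hCr : ∀ Z ∈ 𝓡𝒴', C Z ∈ 𝓡𝒳) (hH₁r : ∀ B ∈ 𝓡ℬ, kerOp kH₁ B ∈ 𝓡𝒴)
    (hΦr : ∀ y : Fin n → ℝ, ‖y‖ ≤ S → Φ (cplx y) ∈ 𝓡ℬ)
    (hskew : ∀ p ∈ Pw, ∀ ℓ ∈ ℓw p, ∀ Y ∈ 𝓡𝒴, ℓ Y ∈ skewAdjoint (Matrix nM nM ℂ))
    -- the frozen background plaquettes (N-ne7cp1-g31-2) and the located count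
    (Bp : 𝔭 → Matrix nM nM ℂ) {d : 𝔭 → ℝ} {dbar : ℝ} (hBu : ∀ p ∈ Pw, Bp p ∈ unitary (Matrix nM nM ℂ))
    (hBd : ∀ p ∈ Pw, ‖Bp p - 1‖ ≤ d p) (hd : ∀ p ∈ Pw, d p ≤ dbar) (hdbar : 0 ≤ dbar)
    {K : ℝ} (hK : ∑ p ∈ Pw, Real.exp (-(δ' * ϖP p)) ≤ K) (β : ℝ) :
    ∀ x ∈ W, ∀ c : ℝ, 1 / 2 ≤ c → c ≤ 1 →
      (fun y => ∑ p ∈ Pw, β * (1 - (Matrix.trace (Bp p * holOf (ℓw p) (fun y => landauExp C (kerOp kι) (kerOp kH)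
        (4 * C₂ * (ε₄ + B₀ * b) ^ 2) (solAt (kerOp k𝒢) 0 W𝒱 ε₄ (0 : Λz → ℭ) (kerOp kH₁ (Φ (cplx y))) +
          kerOp kH₁ (Φ (cplx y)))) y)).re / Fintype.card nM)) (c • x) ≤
      (fun y => ∑ p ∈ Pw, β * (1 - (Matrix.trace (Bp p * holOf (ℓw p) (fun y => landauExp C (kerOp kι) (kerOp kH)
        (4 * C₂ * (ε₄ + B₀ * b) ^ 2) (solAt (kerOp k𝒢) 0 W𝒱 ε₄ (0 : Λz → ℭ) (kerOp kH₁ (Φ (cplx y))) +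
          kerOp kH₁ (Φ (cplx y)))) y)).re / Fintype.card nM)) x +
        (1 - c) * (3 * (|β| * ((dbar +
          (κc' * (B₁p * b / ((1 - B𝒢p * (2 * C₄ * a₃ * Real.exp (δ' * rW))) *
              (1 - 2 * C₂ * R * Real.exp (δ' * rC) * cι * BH))) +
            expTail₂ (mw * (κw' * (B₁p * b / ((1 - B𝒢p * (2 * C₄ * a₃ * Real.exp (δ' * rW))) *
              (1 - 2 * C₂ * R * Real.exp (δ' * rC) * cι * BH))))))) *
          (κc' * (B₁p * b / ((1 - B𝒢p * (2 * C₄ * a₃ * Real.exp (δ' * rW))) *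
              (1 - 2 * C₂ * R * Real.exp (δ' * rC) * cι * BH))) +
            expTail₂ (mw * (κw' * (B₁p * b / ((1 - B𝒢p * (2 * C₄ * a₃ * Real.exp (δ' * rW))) *
              (1 - 2 * C₂ * R * Real.exp (δ' * rC) * cι * BH))))))) * K) / (rΦ / S - 1)) := by
  have hrΦ : 0 < rΦ := hS.trans hSr
  have hb : 0 < b := by have h := hΦ 0 (mem_ball_self hrΦ); rwa [hΦ0, norm_zero] at h
  have hε : 0 < ε₄ + B₀ * b := add_pos_of_nonneg_of_pos hε₄ (mul_pos hB₀ hb)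
  have hR : 0 < R := by linarith
  -- Sect. C's flat list at radius `R∕2`
  have hCq' : ∀ Z : Λ' → 𝔄', ‖Z‖ < R / 2 → ‖C Z‖ ≤ C₂ * ‖Z‖ ^ 2 := fun Z hZ => hCq Z (hZ.trans (by linarith))
  have hCd' : DifferentiableOn ℂ C (ball 0 (R / 2)) := hCd.mono (ball_subset_ball (by linarith))
  have hRC' : 3 * (ε₄ + B₀ * b) ≤ R / 2 := by linarith
  -- the six pinned chain binders, inhabited by S81
  have hGWp := hGWp_of_local hδ' ϖ ϖz k𝒢 hB𝒢p h𝒢p NW hlocW hreachW hC₄ hdom hε hW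
  have hCp := hCp_of_local hδ' ϖ' ϖx NC hlocC hreachC hC₂ hR hCq hCd
  have hk' : 2 * C₂ * R * Real.exp (δ' * rC) * cι * BH < 1 := hk
  exact hE_landau_wilsonSquares_located hS hWS h𝒢 hW hB₀ hC₄ hε₄ hdom hself hcontr (kerOp kH₁) hH₁ hΦd hΦ0 hΦ hSr
    hC₂ hCq' hCd' (kerOp kι) hι (kerOp kH) hH hq hRC' hδ' ϖ
    (WSup.toPiL (𝔄 := 𝔄') (pinW δ' ϖ') 1).symm.toContinuousLinearMap
    (WSup.toPiL (𝔄 := 𝔅) (pinW δ' ϖx) 1).symm.toContinuousLinearMap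
    (WSup.toPiL (𝔄 := 𝔇) (pinW δ' ϖb) 1).symm.toContinuousLinearMap hGWp hqW
    (fun A A' hA hA' => by simpa only [ContinuousLinearEquiv.coe_coe] using hCp A A' hA hA')
    (fun Y => by simpa only [ContinuousLinearEquiv.coe_coe] using norm_conj_kerOp_le kι δ' ϖ ϖ' hιp Y)
    (fun X => by simpa only [ContinuousLinearEquiv.coe_coe] using norm_conj_kerOp_le kH δ' ϖx ϖ hHp X)
    (by positivity) hcι hBH hk' hB₁p
    (fun B => by simpa only [ContinuousLinearEquiv.coe_coe] using norm_conj_kerOp_le kH₁ δ' ϖb ϖ hH₁p B)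
    (fun z hz => by simpa only [ContinuousLinearEquiv.coe_coe] using hΦp_of_support hδ' ϖb hsupp hΦ z hz) hb.le
    ℓw supp ϖP hblind hdepth hϖP hκw' hκc' hℓw hcurl hlenw 𝓡𝒴 h𝓡𝒴 𝓡𝒵 𝓡𝒴' 𝓡𝒳 h𝓡𝒳 𝓡ℬ h𝒢r hWr hιr hHr hCr hH₁r
    hΦr hskew Bp hBu hBd hd hdbar hK β

end Kernels

/-! ## §2 … and with the four linear letters' pinned bounds read from displayed decay kernels (S69 (A)) -/

section Decay

open scoped Matrix.Norms.L2Operator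

variable {𝔖 : Type*}

/-- **THE LOCATED WILSON SUPPLIER WITH NOTHING PINNED LEFT DISPLAYED.**  §1 with ONE pin profile `ϖ : 𝔖 → ℝ` on a common
position space, one-sided `ρ`-Lipschitz (`ϖ x ≤ ϖ y + ρ x y`), composed with the position maps `pos posz pos′ posx posb`
of the five index types, and the four conjugate bounds DISCHARGED by S69 (A) `opNorm_kerOpPin_le` from DISPLAYED DECAY
KERNELS `‖k c b‖ ≤ c₀·e^{−δρ(pos c, pos b)}` ((3.133)∕Thm 3.3, (46), (103) decay-halves TYPE — LOCATORS, not assertions)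
with reduced-rate row sums `Σ_b e^{−(δ−δ′)ρ(x, pos b)} ≤ M` per letter: `B_𝒢p := c_𝒢M_𝒢`, `c_ι := c_ιM_ι`, `B_H := c_HM_H`,
`B₁ₚ := c₁M₁`.  CONCLUSION = §1's with these products; in particular
`z_pin = (c₁M₁)·b∕((1 − (c_𝒢M_𝒢)·(2C₄a₃e^{δ′r_W}))(1 − 2C₂R·e^{δ′r_C}·(c_ιM_ι)·(c_HM_H)))`.
Nothing printed is asserted; no estimate of Bałaban's discharged; NE7c NOT PROVED. [folklore] -/
theorem hE_landau_wilsonSquares_located_of_decay {n : ℕ} {𝔭 : Type*} {W : Set (Fin n → ℝ)} {Pw : Finset 𝔭} {S : ℝ}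
    (hS : 0 < S) (hWS : W ⊆ closedBall (0 : Fin n → ℝ) S)
    {δ' : ℝ} (hδ' : 0 ≤ δ') (ϖ : 𝔖 → ℝ) (ρ : 𝔖 → 𝔖 → ℝ) (hϖ : ∀ x y, ϖ x ≤ ϖ y + ρ x y)
    (pos : Λ → 𝔖) (posz : Λz → 𝔖) (pos' : Λ' → 𝔖) (posx : Λx → 𝔖) (posb : Λb → 𝔖)
    -- the four linear letters as DECAY KERNELS with reduced-rate row sums (DISPLAYED)
    (k𝒢 : Λ → Λz → (ℭ →L[ℂ] 𝔄)) (kι : Λ' → Λ → (𝔄 →L[ℂ] 𝔄')) (kH : Λ → Λx → (𝔅 →L[ℂ] 𝔄))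
    (kH₁ : Λ → Λb → (𝔇 →L[ℂ] 𝔄)) {c𝒢 δ𝒢 M𝒢 cι δι Mι cH δH MH c₁ δ₁ M₁ : ℝ}
    (hc𝒢 : 0 ≤ c𝒢) (hM𝒢 : 0 ≤ M𝒢) (hk𝒢 : ∀ c b', ‖k𝒢 c b'‖ ≤ c𝒢 * Real.exp (-(δ𝒢 * ρ (pos c) (posz b'))))
    (hM𝒢' : ∀ x, ∑ b', Real.exp (-((δ𝒢 - δ') * ρ x (posz b'))) ≤ M𝒢)
    (hcι : 0 ≤ cι) (hMι : 0 ≤ Mι) (hkι : ∀ c b', ‖kι c b'‖ ≤ cι * Real.exp (-(δι * ρ (pos' c) (pos b'))))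
    (hMι' : ∀ x, ∑ b', Real.exp (-((δι - δ') * ρ x (pos b'))) ≤ Mι)
    (hcH : 0 ≤ cH) (hMH : 0 ≤ MH) (hkH : ∀ c b', ‖kH c b'‖ ≤ cH * Real.exp (-(δH * ρ (pos c) (posx b'))))
    (hMH' : ∀ x, ∑ b', Real.exp (-((δH - δ') * ρ x (posx b'))) ≤ MH)
    (hc₁ : 0 ≤ c₁) (hM₁ : 0 ≤ M₁) (hkH₁ : ∀ c b', ‖kH₁ c b'‖ ≤ c₁ * Real.exp (-(δ₁ * ρ (pos c) (posb b'))))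
    (hM₁' : ∀ x, ∑ b', Real.exp (-((δ₁ - δ') * ρ x (posb b'))) ≤ M₁)
    -- the flat lists
    {W𝒱 : (Λ → 𝔄) → (Λz → ℭ)} {B₀ C₄ a₃ ε₄ b : ℝ}
    (h𝒢 : ∀ f, ‖kerOp k𝒢 f‖ ≤ B₀ * ‖f‖) (hW : Prop4Hyp W𝒱 C₄ a₃) (hB₀ : 0 < B₀) (hC₄ : 0 ≤ C₄) (hε₄ : 0 ≤ ε₄)
    (hdom : 2 * (ε₄ + B₀ * b) ≤ a₃) (hself : B₀ * C₄ * (ε₄ + B₀ * b) ^ 2 ≤ ε₄)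
    (hcontr : 4 * B₀ * C₄ * (ε₄ + B₀ * b) < 1) (hH₁ : ∀ B, ‖kerOp kH₁ B‖ ≤ B₀ * ‖B‖)
    {Φ : (Fin n → ℂ) → (Λb → 𝔇)} {rΦ : ℝ} (hΦd : DifferentiableOn ℂ Φ (ball 0 rΦ)) (hΦ0 : Φ 0 = 0)
    (hΦ : ∀ z ∈ ball (0 : Fin n → ℂ) rΦ, ‖Φ z‖ < b) (hSr : S < rΦ)
    {C : (Λ' → 𝔄') → (Λx → 𝔅)} {C₂ R : ℝ} (hC₂ : 0 ≤ C₂) (hCq : ∀ Z : Λ' → 𝔄', ‖Z‖ < R → ‖C Z‖ ≤ C₂ * ‖Z‖ ^ 2)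
    (hCd : DifferentiableOn ℂ C (ball 0 R)) (hι : ∀ Y, ‖kerOp kι Y‖ ≤ ‖Y‖) (hH : ∀ X, ‖kerOp kH X‖ ≤ B₀ * ‖X‖)
    (hq : 9 * C₂ * B₀ * (ε₄ + B₀ * b) < 1) (hRC : 6 * (ε₄ + B₀ * b) ≤ R)
    -- localities with reaches and the block support
    (NW : Λz → Λ → Prop) (hlocW : ∀ A A' : Λ → 𝔄, ∀ c, (∀ b', NW c b' → A b' = A' b') → W𝒱 A c = W𝒱 A' c)
    {rW : ℝ} (hreachW : ∀ c b', NW c b' → ϖ (posz c) - rW ≤ ϖ (pos b'))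
    (NC : Λx → Λ' → Prop) (hlocC : ∀ A A' : Λ' → 𝔄', ∀ c, (∀ b', NC c b' → A b' = A' b') → C A c = C A' c)
    {rC : ℝ} (hreachC : ∀ c b', NC c b' → ϖ (posx c) - rC ≤ ϖ (pos' b'))
    (hsupp : ∀ z : Fin n → ℂ, ∀ i, 0 < ϖ (posb i) → Φ z i = 0)
    -- smallness of the two contraction numbers (DISPLAYED arithmetic on the decay constants)
    (hqW : c𝒢 * M𝒢 * (2 * C₄ * a₃ * Real.exp (δ' * rW)) < 1)
    (hk : 2 * C₂ * R * Real.exp (δ' * rC) * (cι * Mι) * (cH * MH) < 1)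
    -- the weight read-outs: BLIND off located supports, FLAT op-norms, curl op-norm (DISPLAYED), lengths
    (ℓw : 𝔭 → List ((Λ → 𝔄) →L[ℂ] Matrix nM nM ℂ)) (supp : 𝔭 → Finset Λ) (ϖP : 𝔭 → ℝ)
    (hblind : ∀ p ∈ Pw, ∀ ℓ ∈ ℓw p, ∀ A A' : Λ → 𝔄, (∀ b' ∈ supp p, A b' = A' b') → ℓ A = ℓ A')
    (hdepth : ∀ p ∈ Pw, ∀ b' ∈ supp p, ϖP p ≤ ϖ (pos b')) (hϖP : ∀ p ∈ Pw, 0 ≤ ϖP p)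
    {κw' κc' : ℝ} (hκw' : 0 ≤ κw') (hκc' : 0 ≤ κc') (hℓw : ∀ p ∈ Pw, ∀ ℓ ∈ ℓw p, ‖ℓ‖ ≤ κw')
    (hcurl : ∀ p ∈ Pw, ‖(ℓw p).sum‖ ≤ κc')
    {mw : ℕ} (hlenw : ∀ p ∈ Pw, (ℓw p).length ≤ mw)
    -- the real structure (chain (A)) with SKEW weight read-outs (chain (E))
    (𝓡𝒴 : AddSubgroup (Λ → 𝔄)) (h𝓡𝒴 : IsClosed (𝓡𝒴 : Set (Λ → 𝔄))) (𝓡𝒵 : AddSubgroup (Λz → ℭ))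
    (𝓡𝒴' : AddSubgroup (Λ' → 𝔄')) (𝓡𝒳 : AddSubgroup (Λx → 𝔅)) (h𝓡𝒳 : IsClosed (𝓡𝒳 : Set (Λx → 𝔅)))
    (𝓡ℬ : AddSubgroup (Λb → 𝔇))
    (h𝒢r : ∀ f ∈ 𝓡𝒵, kerOp k𝒢 f ∈ 𝓡𝒴) (hWr : ∀ Y ∈ 𝓡𝒴, W𝒱 Y ∈ 𝓡𝒵) (hιr : ∀ Y ∈ 𝓡𝒴, kerOp kι Y ∈ 𝓡𝒴')
    (hHr : ∀ X ∈ 𝓡𝒳, kerOp kH X ∈ 𝓡𝒴) (hCr : ∀ Z ∈ 𝓡𝒴', C Z ∈ 𝓡𝒳) (hH₁r : ∀ B ∈ 𝓡ℬ, kerOp kH₁ B ∈ 𝓡𝒴)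
    (hΦr : ∀ y : Fin n → ℝ, ‖y‖ ≤ S → Φ (cplx y) ∈ 𝓡ℬ)
    (hskew : ∀ p ∈ Pw, ∀ ℓ ∈ ℓw p, ∀ Y ∈ 𝓡𝒴, ℓ Y ∈ skewAdjoint (Matrix nM nM ℂ))
    -- the frozen background plaquettes (N-ne7cp1-g31-2) and the located count
    (Bp : 𝔭 → Matrix nM nM ℂ) {d : 𝔭 → ℝ} {dbar : ℝ} (hBu : ∀ p ∈ Pw, Bp p ∈ unitary (Matrix nM nM ℂ))
    (hBd : ∀ p ∈ Pw, ‖Bp p - 1‖ ≤ d p) (hd : ∀ p ∈ Pw, d p ≤ dbar) (hdbar : 0 ≤ dbar)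
    {K : ℝ} (hK : ∑ p ∈ Pw, Real.exp (-(δ' * ϖP p)) ≤ K) (β : ℝ) :
    ∀ x ∈ W, ∀ c : ℝ, 1 / 2 ≤ c → c ≤ 1 →
      (fun y => ∑ p ∈ Pw, β * (1 - (Matrix.trace (Bp p * holOf (ℓw p) (fun y => landauExp C (kerOp kι) (kerOp kH)
        (4 * C₂ * (ε₄ + B₀ * b) ^ 2) (solAt (kerOp k𝒢) 0 W𝒱 ε₄ (0 : Λz → ℭ) (kerOp kH₁ (Φ (cplx y))) +
          kerOp kH₁ (Φ (cplx y)))) y)).re / Fintype.card nM)) (c • x) ≤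
      (fun y => ∑ p ∈ Pw, β * (1 - (Matrix.trace (Bp p * holOf (ℓw p) (fun y => landauExp C (kerOp kι) (kerOp kH)
        (4 * C₂ * (ε₄ + B₀ * b) ^ 2) (solAt (kerOp k𝒢) 0 W𝒱 ε₄ (0 : Λz → ℭ) (kerOp kH₁ (Φ (cplx y))) +
          kerOp kH₁ (Φ (cplx y)))) y)).re / Fintype.card nM)) x +
        (1 - c) * (3 * (|β| * ((dbar +
          (κc' * (c₁ * M₁ * b / ((1 - c𝒢 * M𝒢 * (2 * C₄ * a₃ * Real.exp (δ' * rW))) *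
              (1 - 2 * C₂ * R * Real.exp (δ' * rC) * (cι * Mι) * (cH * MH)))) +
            expTail₂ (mw * (κw' * (c₁ * M₁ * b / ((1 - c𝒢 * M𝒢 * (2 * C₄ * a₃ * Real.exp (δ' * rW))) *
              (1 - 2 * C₂ * R * Real.exp (δ' * rC) * (cι * Mι) * (cH * MH)))))))) *
          (κc' * (c₁ * M₁ * b / ((1 - c𝒢 * M𝒢 * (2 * C₄ * a₃ * Real.exp (δ' * rW))) *
              (1 - 2 * C₂ * R * Real.exp (δ' * rC) * (cι * Mι) * (cH * MH)))) +
            expTail₂ (mw * (κw' * (c₁ * M₁ * b / ((1 - c𝒢 * M𝒢 * (2 * C₄ * a₃ * Real.exp (δ' * rW))) *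
              (1 - 2 * C₂ * R * Real.exp (δ' * rC) * (cι * Mι) * (cH * MH)))))))) * K) / (rΦ / S - 1)) := by
  -- the four conjugate bounds from the decay kernels (S69 (A))
  have h𝒢p : ‖kerOpPin k𝒢 δ' (ϖ ∘ posz) (ϖ ∘ pos)‖ ≤ c𝒢 * M𝒢 :=
    opNorm_kerOpPin_le k𝒢 ρ posz pos ϖ hc𝒢 hδ' hM𝒢 hk𝒢 hϖ hM𝒢'
  have hιp : ‖kerOpPin kι δ' (ϖ ∘ pos) (ϖ ∘ pos')‖ ≤ cι * Mι :=
    opNorm_kerOpPin_le kι ρ pos pos' ϖ hcι hδ' hMι hkι hϖ hMι'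
  have hHp : ‖kerOpPin kH δ' (ϖ ∘ posx) (ϖ ∘ pos)‖ ≤ cH * MH :=
    opNorm_kerOpPin_le kH ρ posx pos ϖ hcH hδ' hMH hkH hϖ hMH'
  have hH₁p : ‖kerOpPin kH₁ δ' (ϖ ∘ posb) (ϖ ∘ pos)‖ ≤ c₁ * M₁ :=
    opNorm_kerOpPin_le kH₁ ρ posb pos ϖ hc₁ hδ' hM₁ hkH₁ hϖ hM₁'
  exact hE_landau_wilsonSquares_located_of_kernels hS hWS hδ' (ϖ ∘ pos) (ϖ ∘ posz) (ϖ ∘ pos') (ϖ ∘ posx) (ϖ ∘ posb)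
    k𝒢 kι kH kH₁ (mul_nonneg hc𝒢 hM𝒢) (mul_nonneg hcι hMι) (mul_nonneg hcH hMH) (mul_nonneg hc₁ hM₁) h𝒢p hιp hHp
    hH₁p h𝒢 hW hB₀ hC₄ hε₄ hdom hself hcontr hH₁ hΦd hΦ0 hΦ hSr hC₂ hCq hCd hι hH hq hRC NW hlocW hreachW NC hlocC
    hreachC hsupp hqW hk ℓw supp ϖP hblind hdepth hϖP hκw' hκc' hℓw hcurl hlenw 𝓡𝒴 h𝓡𝒴 𝓡𝒵 𝓡𝒴' 𝓡𝒳 h𝓡𝒳 𝓡ℬ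
    h𝒢r hWr hιr hHr hCr hH₁r hΦr hskew Bp hBu hBd hd hdbar hK β

end Decay

end Summit.QuantumFields.BalabanUV.T4Continuum.ShellMeasureLandauWilsonSquaresKernels

end
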